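import Mathlib
import Summits.Ventures.LatticeQCDFlow.Scaling.TorusHeightDecomposition

/-!
# LatticeQCDFlow / Scaling — the torus as a slab chain: the sum of the `U(1)` plaquette cosines of
# the torus is the slab-chain cost, and the plaquette observables are layer cosines

HONEST FRAMING: exact (Metropolis-corrected) sampling algorithms for lattice gauge theory;
figures of merit are autocorrelation/cost numbers at stated couplings and volumes; no
continuum-physics claim.

Venture `LatticeQCDFlow` (cell pub-lqcd), topic `Scaling`, FANOUT row 30 (lean-1) — OUR WORK (LEAD
LINE 230 (G3′)), lattice file 7 of the slab-chain proof of (LC) at every separation.  With the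
height reading `heightCfg` of `Scaling/TorusHeightDecomposition.lean` (`L = n+1`, axis `a`, heights
reversed):
* `hplaqCos`, `layerCost` — the cosine of a horizontal plaquette of a layer read on the layer
  variables, and their sum over the layer; `u1Chain d n a` — the `U(1)` slab chain
  (`a_h = layerCost`, `s_h = slabCost` for every `h`);
* `siteEquivLayer`, `siteEquivSlab` — sites of the torus as (height, layer site) for the two
  height readings;
* **`sum_plaquetteCos_eq_cost`** — `Σ_{genuine plaquettes q} Re U_q(W) = (u1Chain).cost (heightCfg W)`:
  the genuine labels `(x; k<l)` split into horizontal ones (`k, l ≠ a`, summed by layer) and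
  lateral ones (`k = a` or `l = a`, summed by slab and layer edge, the reversed label having the
  conjugate holonomy);
* **`plaquetteHolonomy_axisSite_eq_plaqChar`** — the plaquette `(i,j)` based at the site
  `−t·e_a` is the layer plaquette of the layer at height `t`: its holonomy is
  `plaqChar (layerCfg W t)`, so its cosine is `xObs (layerCfg W t)`.
Elementary; nothing is cited as a fact; `def`s `hplaqCos`, `layerCost`, `u1Chain`,
`siteEquivLayer`, `siteEquivSlab`; no `sorry`.
-/

noncomputable section

open MeasureTheory Filter Finset
open Literature.MathematicalPhysics.QuantumFieldTheory

namespace Summit.Ventures.LatticeQCDFlow.Theory2.Lattice.U1Layer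

variable {d n : ℕ} {a : Fin d}

/-! ## 1. The `U(1)` slab chain of the torus -/

/-- The cosine of the horizontal plaquette `(y; k, l)` of a layer (`k, l ≠ a`), read on the layer
variables. [folklore] -/
def hplaqCos (e : LEdge d (n + 1) a → Circle) (y : LSite d (n + 1) a) (k l : Fin d) (hk : k ≠ a)
    (hl : l ≠ a) : ℝ :=
  ((e ⟨(y, k), hk⟩ * e ⟨(LEdge.tgt ⟨(y, k), hk⟩, l), hl⟩ *
    (e ⟨(LEdge.tgt ⟨(y, l), hl⟩, k), hk⟩)⁻¹ * (e ⟨(y, l), hl⟩)⁻¹ : Circle) : ℂ).re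

/-- **The in-layer cost**: the sum of the cosines of the genuine horizontal plaquettes of a layer.
[folklore] -/
def layerCost (a : Fin d) (e : LEdge d (n + 1) a → Circle) : ℝ :=
  ∑ y : LSite d (n + 1) a, ∑ k : Fin d, ∑ l : Fin d,
    if h : k < l ∧ k ≠ a ∧ l ≠ a then hplaqCos e y k l h.2.1 h.2.2 else 0

/-- **The `U(1)` slab chain of the torus** `(ℤ/(n+1))^d` along the axis `a`. [folklore] -/
def u1Chain (d n : ℕ) (a : Fin d) :
    SlabChain n (LEdge d (n + 1) a → Circle) (LSite d (n + 1) a → Circle) where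
  a := fun _ => layerCost a
  s := fun _ => slabCost

/-! ## 2. Sites as (height, layer site) -/

/-- Sites of the torus as (height, layer site), the height of `x` being `−x_a`. [folklore] -/
def siteEquivLayer (a : Fin d) : Fin (n + 1) × LSite d (n + 1) a ≃ Site d (n + 1) where
  toFun p := Function.update p.2.1 a (-(toZ p.1))
  invFun x := (toF (-(x a)), baseSite a x)
  left_inv p := by
    rcases p with ⟨h, y⟩
    refine Prod.ext ?_ (Subtype.ext (update_update_base y _))
    show toF (-(Function.update y.1 a (-(toZ h)) a)) = h
    rw [Function.update_self, neg_neg, toF_toZ]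
  right_inv x := by
    show Function.update (Function.update x a 0) a (-(toZ (toF (-(x a))))) = x
    rw [toZ_toF, Function.update_idem, neg_neg, Function.update_eq_self]

/-- Sites of the torus as (slab, layer site), the slab of `x` being `−x_a − 1`. [folklore] -/
def siteEquivSlab (a : Fin d) : Fin (n + 1) × LSite d (n + 1) a ≃ Site d (n + 1) where
  toFun p := Function.update p.2.1 a (-(toZ p.1) - 1)
  invFun x := (toF (-(x a) - 1), baseSite a x)
  left_inv p := by
    rcases p with ⟨h, y⟩
    refine Prod.ext ?_ (Subtype.ext (update_update_base y _))
    show toF (-(Function.update y.1 a (-(toZ h) - 1) a) - 1) = h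
    rw [Function.update_self, show -(-toZ h - 1) - 1 = toZ h by ring, toF_toZ]
  right_inv x := by
    show Function.update (Function.update x a 0) a (-(toZ (toF (-(x a) - 1))) - 1) = x
    rw [toZ_toF, Function.update_idem, show -(-(x a) - 1) - 1 = x a by ring, Function.update_eq_self]

/-! ## 3. The plaquette sum is the slab-chain cost -/

/-- The cosine of the plaquette `(x; k, l)`. [folklore] -/
abbrev pcos (W : GaugeConfig d (n + 1) Circle) (x : Site d (n + 1)) (k l : Fin d) : ℝ :=
  ((plaquetteHolonomy W x k l : Circle) : ℂ).re

/-- Splitting the genuine labels at a site: horizontal, first direction the axis, second direction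
the axis. [folklore] -/
theorem ite_lt_split (a k l : Fin d) (c : ℝ) :
    (if k < l then c else 0) =
      (if k < l ∧ k ≠ a ∧ l ≠ a then c else 0) + (if k = a ∧ a < l then c else 0) +
        (if l = a ∧ k < a then c else 0) := by
  by_cases hk : k = a
  · subst hk
    by_cases hkl : k < l
    · simp [hkl, ne_of_gt hkl]
    · simp [hkl]
  · by_cases hl : l = a
    · subst hl
      simp [hk]
    · simp [hk, hl]

/-- Sum over a layer edge as a sum over (site, direction) with the side condition. [folklore] -/
theorem sum_LEdge_eq_sum_dite (g : LEdge d (n + 1) a → ℝ) :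
    ∑ ℓ : LEdge d (n + 1) a, g ℓ =
      ∑ y : LSite d (n + 1) a, ∑ b : Fin d, if hb : b ≠ a then g ⟨(y, b), hb⟩ else 0 := by
  have h1 : ∑ ℓ : LEdge d (n + 1) a, g ℓ = ∑ ℓ : LEdge d (n + 1) a,
      (fun e : LSite d (n + 1) a × Fin d => if hb : e.2 ≠ a then g ⟨e, hb⟩ else 0) ℓ.1 :=
    Fintype.sum_congr _ _ fun ℓ => by simp only [dif_pos ℓ.2]; rfl
  have h2 : ∑ e ∈ univ.filter (fun e : LSite d (n + 1) a × Fin d => e.2 ≠ a),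
      (fun e : LSite d (n + 1) a × Fin d => if hb : e.2 ≠ a then g ⟨e, hb⟩ else 0) e =
      ∑ ℓ : LEdge d (n + 1) a,
        (fun e : LSite d (n + 1) a × Fin d => if hb : e.2 ≠ a then g ⟨e, hb⟩ else 0) ℓ.1 :=
    Finset.sum_subtype _ (fun e => by simp) _
  have h3 : ∑ e ∈ univ.filter (fun e : LSite d (n + 1) a × Fin d => e.2 ≠ a),
      (fun e : LSite d (n + 1) a × Fin d => if hb : e.2 ≠ a then g ⟨e, hb⟩ else 0) e =
      ∑ e : LSite d (n + 1) a × Fin d,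
        (fun e : LSite d (n + 1) a × Fin d => if hb : e.2 ≠ a then g ⟨e, hb⟩ else 0) e :=
    Finset.sum_filter_of_ne fun e _ hne => by
      by_cases he : e.2 ≠ a
      · exact he
      · exact absurd (dif_neg he) hne
  rw [h1, ← h2, h3, Fintype.sum_prod_type]

/-- **THE PLAQUETTE SUM IS THE SLAB-CHAIN COST**: the sum of the cosines of all genuine plaquettes
of the torus equals the cost of the `U(1)` slab chain on the configuration read by heights. [folklore] -/
theorem sum_plaquetteCos_eq_cost (W : GaugeConfig d (n + 1) Circle) :
    ∑ q ∈ torusGenuine d (n + 1), pcos W q.1 q.2.1 q.2.2 = (u1Chain d n a).cost (heightCfg a W) := by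
  -- the left side as a triple sum with the three-way split
  have hL : ∑ q ∈ torusGenuine d (n + 1), pcos W q.1 q.2.1 q.2.2 =
      ∑ x : Site d (n + 1), ∑ k : Fin d, ∑ l : Fin d, if k < l then pcos W x k l else 0 := by
    rw [torusGenuine, Finset.sum_filter]
    simp only [Fintype.sum_prod_type]
  rw [hL]
  simp_rw [ite_lt_split a]
  simp only [Finset.sum_add_distrib]
  rw [add_assoc]
  -- the cost
  have hR : (u1Chain d n a).cost (heightCfg a W) =
      ∑ h : Fin (n + 1), layerCost a (layerCfg a W h) +
        ∑ h : Fin (n + 1), slabCost (layerCfg a W h) (vertCfg a W h) (layerCfg a W (h + 1)) := rfl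
  rw [hR]
  congr 1
  · -- horizontal plaquettes, by layer
    rw [← (siteEquivLayer (n := n) a).sum_comp, Fintype.sum_prod_type]
    refine sum_congr rfl fun h _ => ?_
    unfold layerCost
    refine sum_congr rfl fun y _ => sum_congr rfl fun k _ => sum_congr rfl fun l _ => ?_
    by_cases hkl : k < l ∧ k ≠ a ∧ l ≠ a
    · rw [if_pos hkl, dif_pos hkl]
      show pcos W (Function.update y.1 a (-(toZ h))) k l = _
      rw [pcos, plaquetteHolonomy_horizontal W h y hkl.2.1 hkl.2.2, hplaqCos]
    · rw [if_neg hkl, dif_neg hkl]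
  · -- lateral plaquettes, by slab
    rw [← Finset.sum_add_distrib, ← (siteEquivSlab (n := n) a).sum_comp, Fintype.sum_prod_type]
    refine sum_congr rfl fun h _ => ?_
    rw [slabCost, sum_LEdge_eq_sum_dite]
    refine sum_congr rfl fun y _ => ?_
    show (∑ k, ∑ l, if k = a ∧ a < l then pcos W (Function.update y.1 a (-(toZ h) - 1)) k l else 0) +
        (∑ k, ∑ l, if l = a ∧ k < a then pcos W (Function.update y.1 a (-(toZ h) - 1)) k l else 0) = _
    -- collapse the direction forced to be the axis
    have hA : (∑ k : Fin d, ∑ l : Fin d, if k = a ∧ a < l then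
        pcos W (Function.update y.1 a (-(toZ h) - 1)) k l else 0) =
        ∑ l : Fin d, if a < l then pcos W (Function.update y.1 a (-(toZ h) - 1)) a l else 0 := by
      rw [Finset.sum_comm]
      refine sum_congr rfl fun l _ => ?_
      rw [Finset.sum_eq_single a (fun k _ hk => by simp [hk]) (fun h => absurd (mem_univ a) h)]
      simp
    have hB : (∑ k : Fin d, ∑ l : Fin d, if l = a ∧ k < a then
        pcos W (Function.update y.1 a (-(toZ h) - 1)) k l else 0) =
        ∑ k : Fin d, if k < a then pcos W (Function.update y.1 a (-(toZ h) - 1)) k a else 0 := by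
      refine sum_congr rfl fun k _ => ?_
      rw [Finset.sum_eq_single a (fun l _ hl => by simp [hl]) (fun h => absurd (mem_univ a) h)]
      simp
    rw [hA, hB, ← Finset.sum_add_distrib]
    refine sum_congr rfl fun b _ => ?_
    rcases lt_trichotomy a b with hab | rfl | hba
    · rw [if_pos hab, if_neg (not_lt.2 hab.le), dif_pos (ne_of_gt hab), add_zero, pcos,
        plaquetteHolonomy_lateral W h y (ne_of_gt hab)]
    · simp
    · rw [if_neg (not_lt.2 hba.le), if_pos hba, dif_pos (ne_of_lt hba), zero_add, pcos,
        plaquetteHolonomy_lateral_rev W h y (ne_of_lt hba), Circle.coe_inv_eq_conj, Complex.conj_re]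

/-! ## 4. The plaquette observables are layer cosines -/

/-- The site `−t·e_a` in height coordinates. [folklore] -/
theorem update_zero_eq_neg_single (τ : Fin (n + 1)) :
    (Function.update (0 : Site d (n + 1)) a (-(toZ τ)) : Site d (n + 1)) = -Pi.single a (toZ τ) := by
  funext k
  by_cases hk : k = a
  · subst hk; simp
  · simp [hk]

/-- **The plaquette `(i, j)` based at `−t·e_a` is the layer plaquette of the layer at height `t`**:
its holonomy is `plaqChar (layerCfg W t)`. [folklore] -/
theorem plaquetteHolonomy_axisSite_eq_plaqChar {i j : Fin d} (hi : i ≠ a) (hj : j ≠ a)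
    (W : GaugeConfig d (n + 1) Circle) (τ : Fin (n + 1)) :
    plaquetteHolonomy W (Function.update (0 : Site d (n + 1)) a (-(toZ τ))) i j =
      plaqChar hi hj (layerCfg a W τ) := by
  have hh := plaquetteHolonomy_horizontal W τ (zsite d (n + 1) a) hi hj
  rw [show ((zsite d (n + 1) a).1 : Site d (n + 1)) = 0 from rfl] at hh
  have ht0 : (pedge (L := n + 1) hi hj 0).tgt = usite hi := by
    apply Subtype.ext; simp [LEdge.tgt, pedge, zsite, usite, Site.shift]
  have ht3 : (pedge (L := n + 1) hi hj 3).tgt = usite hj := by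
    apply Subtype.ext; simp [LEdge.tgt, pedge, zsite, usite, Site.shift]
  rw [hh]
  unfold plaqChar
  simp only [Fin.prod_univ_four, psgn, Fin.isValue, zpow_one, zpow_neg]
  simp only [show (0 : Fin 4) = ⟨0, by omega⟩ from rfl, show (1 : Fin 4) = ⟨1, by omega⟩ from rfl,
    show (2 : Fin 4) = ⟨2, by omega⟩ from rfl, show (3 : Fin 4) = ⟨3, by omega⟩ from rfl] at ht0 ht3 ⊢
  simp only [pedge] at ht0 ht3 ⊢
  rw [ht0, ht3]

/-- Its cosine is the layer cosine `xObs (layerCfg W t)`. [folklore] -/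
theorem pcos_axisSite_eq_xObs {i j : Fin d} (hi : i ≠ a) (hj : j ≠ a)
    (W : GaugeConfig d (n + 1) Circle) (τ : Fin (n + 1)) :
    pcos W (Function.update (0 : Site d (n + 1)) a (-(toZ τ))) i j = xObs hi hj (layerCfg a W τ) := by
  rw [pcos, plaquetteHolonomy_axisSite_eq_plaqChar hi hj, xObs]

end Summit.Ventures.LatticeQCDFlow.Theory2.Lattice.U1Layer

end
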